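import Literature.MathematicalPhysics.QuantumLattice.BdGNambuLogDetMoments
import Mathlib.Analysis.PSeries
import HarnessLib

/-!
# Bookkeeping for string/complement cuts on the fermionic torus

Topic `Literature/MathematicalPhysics/QuantumLattice` (family `hubbard`), sequel of the torus
section of `BdGNambuLogDetMoments.lean`: the elementary, model-independent inequalities by which a
crossing Hilbert–Schmidt sum `S(t) = Σ_{a ∈ A, b ∈ B} ‖G_t(a,b)‖²` of a lattice resolvent across a
cut (string orbitals `A` = columns `< R` of two rows, complement `B`) is bounded from TWO
summation-by-parts decay bounds `‖G_t(a,b)‖ ≤ u/d`, `‖G_t(a,b)‖ ≤ v/d²` (`d` = column distance)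
with logarithmically divergent `u ~ 1 + |log t|` and `v ~ 1/t` — the standard infrared bookkeeping
for vison / flux-string perturbations of nodal lattice BdG Hamiltonians (Senthil–Fisher 2000,
§III–IV).  Fully proved, no definition is introduced:

* **interpolation** `g² = g^{7/4} g^{1/4} ≤ u^{7/4} v^{1/4} d^{-9/4}` (`sq_le_interp`,
  `sq_le_interp_rpow`): summable in `d` with weight `d` and integrable in `t` after squaring;
* **log absorption** `1 + |log t| ≤ K(ε,t₀) t^{-ε}` on `(0, t₀]` (`exists_one_add_abs_log_le`) and
  power trading `t^{-α} ≤ t₀^γ t^{-(α+γ)}` (`one_le_rpow_mul_rpow_neg`, `rpow_neg_le_rpow_neg_add`);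
* **factorisation through the cut** `(u+v)^{-9/4} ≤ v^{-9/8}(u+1)^{-9/8}` for `u ≥ 0`, `v ≥ 1`
  (`(u+v)² ≥ v(u+1)`; `rpow_add_le_mul_rpow`, `natCast_rpow_le`), so that a double sum of
  `d(a,b)^{-9/4}` over the two sides of a cut is a product of two convergent single sums, each
  controlled by `sum_le_of_fiber_card_le` (a sum along an at-most-`k`-to-one map is `≤ k Σ'`);
* **orbital counting on `Orb (FermionTorus 2 L)`**: an orbital is determined by its two torus
  coordinates and its index (`orb_fermionTorus_ext`); a column carries `≤ 4` orbitals of the rows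
  `0, 1` (`card_orb_col_rows01_le`), a row carries `≤ 2L` orbitals (`card_orb_row_le`); and the
  torus distance formula `min((a−b).val,(b−a).val) = min(a.val+L−b.val, b.val−a.val)`
  (`zmod_min_val_sub_eq`).

## Mathlib / tree search

REUSED (Mathlib): `Real.log_le_rpow_div`, `Real.rpow_le_rpow_of_nonpos`, `Real.summable_nat_rpow`
(consumer side), `Summable.sum_le_tsum`, `Finset.sum_comp`, `Finset.card_le_card_of_injOn`.
REUSED (tree): `zmod_val_sub_cases` (`BdGNambuLogDetMoments`), `FermionTorus.equivTorusSite`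
(`HubbardModel`).  `lean search 'log_le_rpow_div|rpow_add_le_mul'`: only the Mathlib lemma and
unrelated number-theory variants (`log_le_rpow_div'` for `u ≥ 1`).

## References

* T. Senthil, M. P. A. Fisher, *Z₂ gauge theory of electron fractionalization in strongly
  correlated systems*, Phys. Rev. B 62 (2000) 7850, §III–IV. [SenthilFisher2000]
* G. H. Hardy, J. E. Littlewood, G. Pólya, *Inequalities* (1934), §2.7–2.8 (weighted geometric
  means, Hölder). [HardyLittlewoodPolya1934]
-/

noncomputable section

namespace Literature.MathematicalPhysics.QuantumLattice

/-! ### Powers and logarithms -/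

/-- Log absorption: `1 + |log t| ≤ K t^{-ε}` on `(0, t₀]` (`log x ≤ x^ε/ε`). [folklore] -/
theorem exists_one_add_abs_log_le {ε t₀ : ℝ} (hε : 0 < ε) (ht₀ : 1 ≤ t₀) :
    ∃ K : ℝ, 0 ≤ K ∧ ∀ t : ℝ, 0 < t → t ≤ t₀ → 1 + |Real.log t| ≤ K * t ^ (-ε) := by
  have hlog₀ : 0 ≤ Real.log t₀ := Real.log_nonneg ht₀
  have hε' : 0 ≤ 1 / ε := by positivity
  have hK₀ : 0 ≤ 1 + 1 / ε + Real.log t₀ := by linarith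
  refine ⟨(1 + 1 / ε + Real.log t₀) * t₀ ^ ε, mul_nonneg hK₀ (Real.rpow_nonneg (by linarith) _),
    fun t ht htt₀ => ?_⟩
  have hK₁ : 1 + 1 / ε ≤ (1 + 1 / ε + Real.log t₀) * t₀ ^ ε :=
    calc 1 + 1 / ε ≤ 1 + 1 / ε + Real.log t₀ := le_add_of_nonneg_right hlog₀
      _ ≤ _ := le_mul_of_one_le_right hK₀ (Real.one_le_rpow ht₀ hε.le)
  rcases le_or_gt t 1 with ht1 | ht1
  · have hpow : 1 ≤ t ^ (-ε) := Real.one_le_rpow_of_pos_of_le_one_of_nonpos ht ht1 (by linarith)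
    have hlog : |Real.log t| ≤ t ^ (-ε) / ε := by
      rw [abs_of_nonpos (Real.log_nonpos ht.le ht1), ← Real.log_inv, Real.rpow_neg ht.le,
        ← Real.inv_rpow ht.le]
      exact Real.log_le_rpow_div (inv_nonneg.mpr ht.le) hε
    calc 1 + |Real.log t| ≤ t ^ (-ε) + t ^ (-ε) / ε := add_le_add hpow hlog
      _ = (1 + 1 / ε) * t ^ (-ε) := by ring
      _ ≤ _ := mul_le_mul_of_nonneg_right hK₁ (by positivity)
  · have hlog : |Real.log t| ≤ Real.log t₀ := by
      rw [abs_of_nonneg (Real.log_nonneg ht1.le)]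
      exact Real.log_le_log ht htt₀
    have hpow : t₀ ^ (-ε) ≤ t ^ (-ε) := Real.rpow_le_rpow_of_nonpos ht htt₀ (by linarith)
    have ht₀pos : 0 < t₀ := by linarith
    calc 1 + |Real.log t| ≤ 1 + 1 / ε + Real.log t₀ := by linarith
      _ = (1 + 1 / ε + Real.log t₀) * t₀ ^ ε * t₀ ^ (-ε) := by
          rw [mul_assoc, ← Real.rpow_add ht₀pos, add_neg_cancel, Real.rpow_zero, mul_one]
      _ ≤ _ := mul_le_mul_of_nonneg_left hpow (mul_nonneg hK₀ (Real.rpow_nonneg ht₀pos.le _))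

/-- `1 ≤ t₀^γ t^{-γ}` for `0 < t ≤ t₀`, `γ ≥ 0`. [folklore] -/
theorem one_le_rpow_mul_rpow_neg {t t₀ γ : ℝ} (ht : 0 < t) (htt₀ : t ≤ t₀) (hγ : 0 ≤ γ) :
    1 ≤ t₀ ^ γ * t ^ (-γ) := by
  have ht₀ : 0 < t₀ := ht.trans_le htt₀
  calc (1 : ℝ) = t₀ ^ γ * t₀ ^ (-γ) := by
        rw [Real.rpow_neg ht₀.le, mul_inv_cancel₀ (Real.rpow_pos_of_pos ht₀ γ).ne']
    _ ≤ t₀ ^ γ * t ^ (-γ) :=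
        mul_le_mul_of_nonneg_left (Real.rpow_le_rpow_of_nonpos ht htt₀ (by linarith))
          (Real.rpow_nonneg ht₀.le γ)

/-- Power trading: `t^{-α} ≤ t₀^γ t^{-(α+γ)}` for `0 < t ≤ t₀`, `γ ≥ 0`. [folklore] -/
theorem rpow_neg_le_rpow_neg_add {t t₀ α γ : ℝ} (ht : 0 < t) (htt₀ : t ≤ t₀) (hγ : 0 ≤ γ) :
    t ^ (-α) ≤ t₀ ^ γ * t ^ (-(α + γ)) :=
  calc t ^ (-α) = 1 * t ^ (-α) := (one_mul _).symm
    _ ≤ (t₀ ^ γ * t ^ (-γ)) * t ^ (-α) :=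
        mul_le_mul_of_nonneg_right (one_le_rpow_mul_rpow_neg ht htt₀ hγ)
          (Real.rpow_nonneg ht.le _)
    _ = t₀ ^ γ * t ^ (-(α + γ)) := by
        rw [mul_assoc, ← Real.rpow_add ht]; ring_nf

/-- Interpolation of two decay bounds: `g ≤ u/d` and `g ≤ v/d²` give
`g² = g^{7/4} g^{1/4} ≤ u^{7/4} v^{1/4} d^{-9/4}` (weighted geometric mean). [folklore] -/
theorem sq_le_interp {g u v d : ℝ} (hg : 0 ≤ g) (hu : 0 ≤ u) (hv : 0 ≤ v) (hd : 0 < d)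
    (h1 : g ≤ u / d) (h2 : g ≤ v / d ^ 2) :
    g ^ 2 ≤ u ^ (7 / 4 : ℝ) * v ^ (1 / 4 : ℝ) * d ^ (-(9 / 4) : ℝ) := by
  have hsplit : g ^ 2 = g ^ (7 / 4 : ℝ) * g ^ (1 / 4 : ℝ) := by
    rw [← Real.rpow_add' hg (by norm_num), ← Real.rpow_natCast]; norm_num
  have e1 : (u / d) ^ (7 / 4 : ℝ) = u ^ (7 / 4 : ℝ) * d ^ (-(7 / 4) : ℝ) := by
    rw [Real.div_rpow hu hd.le, Real.rpow_neg hd.le, div_eq_mul_inv]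
  have e2 : (v / d ^ 2) ^ (1 / 4 : ℝ) = v ^ (1 / 4 : ℝ) * d ^ (-(1 / 2) : ℝ) := by
    rw [Real.div_rpow hv (by positivity), Real.rpow_neg hd.le, div_eq_mul_inv,
      show (d ^ 2 : ℝ) = d ^ (2 : ℝ) by rw [← Real.rpow_natCast]; norm_num, ← Real.rpow_mul hd.le]
    norm_num
  have e3 : d ^ (-(9 / 4) : ℝ) = d ^ (-(7 / 4) : ℝ) * d ^ (-(1 / 2) : ℝ) := by
    rw [← Real.rpow_add hd]; norm_num
  rw [hsplit, e3]
  calc g ^ (7 / 4 : ℝ) * g ^ (1 / 4 : ℝ) ≤ (u / d) ^ (7 / 4 : ℝ) * (v / d ^ 2) ^ (1 / 4 : ℝ) :=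
        mul_le_mul (Real.rpow_le_rpow hg h1 (by norm_num)) (Real.rpow_le_rpow hg h2 (by norm_num))
          (Real.rpow_nonneg hg _) (Real.rpow_nonneg (div_nonneg hu hd.le) _)
    _ = _ := by rw [e1, e2]; ring

/-- The interpolated pair weight with an explicit time dependence: `g ≤ U t^{-ε}/d` and
`g ≤ V t^{-1}/d²` give `g² ≤ U^{7/4} V^{1/4} t^{-(7ε/4 + 1/4)} d^{-9/4}`. [folklore] -/
theorem sq_le_interp_rpow {g U V t d ε : ℝ} (hg : 0 ≤ g) (hU : 0 ≤ U) (hV : 0 ≤ V) (ht : 0 < t)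
    (hd : 0 < d) (h1 : g ≤ U * t ^ (-ε) / d) (h2 : g ≤ V * t⁻¹ / d ^ 2) :
    g ^ 2 ≤ U ^ (7 / 4 : ℝ) * V ^ (1 / 4 : ℝ) * t ^ (-(7 * ε / 4 + 1 / 4)) * d ^ (-(9 / 4) : ℝ) := by
  have e1 : (U * t ^ (-ε)) ^ (7 / 4 : ℝ) = U ^ (7 / 4 : ℝ) * t ^ (-ε * (7 / 4)) := by
    rw [Real.mul_rpow hU (Real.rpow_nonneg ht.le _), ← Real.rpow_mul ht.le]
  have e2 : (V * t⁻¹) ^ (1 / 4 : ℝ) = V ^ (1 / 4 : ℝ) * t ^ (-(1 / 4) : ℝ) := by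
    rw [Real.mul_rpow hV (inv_nonneg.mpr ht.le), Real.inv_rpow ht.le, Real.rpow_neg ht.le]
  have e3 : t ^ (-ε * (7 / 4)) * t ^ (-(1 / 4) : ℝ) = t ^ (-(7 * ε / 4 + 1 / 4)) := by
    rw [← Real.rpow_add ht]; ring_nf
  calc g ^ 2 ≤ _ := sq_le_interp hg (by positivity) (by positivity) hd h1 h2
    _ = _ := by rw [e1, e2, ← e3]; ring

/-- Factorisation through the cut: `(u+v)^{-9/4} ≤ v^{-9/8} (u+1)^{-9/8}` for `u ≥ 0`, `v ≥ 1`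
(because `(u+v)² ≥ v(u+1)`). [folklore] -/
theorem rpow_add_le_mul_rpow {u v : ℝ} (hu : 0 ≤ u) (hv : 1 ≤ v) :
    (u + v) ^ (-(9 / 4) : ℝ) ≤ v ^ (-(9 / 8) : ℝ) * (u + 1) ^ (-(9 / 8) : ℝ) := by
  have hpos : 0 < v * (u + 1) := by positivity
  have hle : v * (u + 1) ≤ (u + v) ^ 2 := by
    nlinarith [mul_nonneg hu (by linarith : (0 : ℝ) ≤ v), sq_nonneg u,
      mul_nonneg (by linarith : (0 : ℝ) ≤ v) (by linarith : (0 : ℝ) ≤ v - 1)]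
  calc (u + v) ^ (-(9 / 4) : ℝ) = ((u + v) ^ 2) ^ (-(9 / 8) : ℝ) := by
        rw [show ((u + v) ^ 2 : ℝ) = (u + v) ^ (2 : ℝ) by rw [← Real.rpow_natCast]; norm_num,
          ← Real.rpow_mul (by positivity)]
        norm_num
    _ ≤ (v * (u + 1)) ^ (-(9 / 8) : ℝ) := Real.rpow_le_rpow_of_nonpos hpos hle (by norm_num)
    _ = _ := Real.mul_rpow (by linarith) (by positivity)

/-- The natural-number form of `rpow_add_le_mul_rpow`: `n^{-9/4} ≤ p^{-9/8} q^{-9/8}` whenever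
`n + 1 = p + q` with `p, q ≥ 1`. [folklore] -/
theorem natCast_rpow_le {n p q : ℕ} (hp : 1 ≤ p) (hq : 1 ≤ q) (h : n + 1 = p + q) :
    (n : ℝ) ^ (-(9 / 4) : ℝ) ≤ (p : ℝ) ^ (-(9 / 8) : ℝ) * (q : ℝ) ^ (-(9 / 8) : ℝ) := by
  have hn : (n : ℝ) = ((q : ℝ) - 1) + p := by
    have : (n : ℝ) + 1 = p + q := by exact_mod_cast h
    linarith
  have hq' : (0 : ℝ) ≤ (q : ℝ) - 1 := by
    have : (1 : ℝ) ≤ q := by exact_mod_cast hq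
    linarith
  have hp' : (1 : ℝ) ≤ p := by exact_mod_cast hp
  have key := rpow_add_le_mul_rpow hq' hp'
  rwa [sub_add_cancel, ← hn] at key

/-- A sum of a nonnegative summable sequence along an at-most-`k`-to-one map is `≤ k · Σ'`.
[folklore] -/
theorem sum_le_of_fiber_card_le {α : Type*} [DecidableEq α] (s : Finset α) (m : α → ℕ)
    (g : ℕ → ℝ) (k : ℕ) (hg : ∀ n, 0 ≤ g n) (hs : Summable g)
    (hk : ∀ n, (s.filter fun a => m a = n).card ≤ k) :
    ∑ a ∈ s, g (m a) ≤ k * ∑' n, g n := by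
  rw [Finset.sum_comp]
  calc ∑ n ∈ s.image m, (s.filter fun a => m a = n).card • g n
      ≤ ∑ n ∈ s.image m, (k : ℝ) * g n := Finset.sum_le_sum fun n _ => by
        rw [nsmul_eq_mul]; exact mul_le_mul_of_nonneg_right (Nat.cast_le.mpr (hk n)) (hg n)
    _ = k * ∑ n ∈ s.image m, g n := (Finset.mul_sum _ _ _).symm
    _ ≤ k * ∑' n, g n :=
        mul_le_mul_of_nonneg_left (hs.sum_le_tsum _ fun n _ => hg n) (Nat.cast_nonneg _)

/-! ### Orbital counting on the fermionic `2`-torus -/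

section Torus

variable {L : ℕ} [NeZero L]

/-- An orbital of the fermionic `2`-torus is determined by its two torus coordinates and its
index. [folklore] -/
theorem orb_fermionTorus_ext {o o' : Orb (FermionTorus 2 L)}
    (h0 : FermionTorus.toTorusSite (ofLex o).1 0 = FermionTorus.toTorusSite (ofLex o').1 0)
    (h1 : FermionTorus.toTorusSite (ofLex o).1 1 = FermionTorus.toTorusSite (ofLex o').1 1)
    (h2 : (ofLex o).2 = (ofLex o').2) : o = o' := by
  have h : (ofLex o).1 = (ofLex o').1 := by
    apply FermionTorus.equivTorusSite.injective
    funext i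
    fin_cases i
    exacts [h0, h1]
  exact ofLex.injective (Prod.ext h h2)

/-- Over a given column at most `4` orbitals lie in the rows `0, 1` (`2` rows, `2` indices).
[folklore] -/
theorem card_orb_col_rows01_le (c₀ : ℕ) :
    (Finset.univ.filter fun o : Orb (FermionTorus 2 L) =>
        (FermionTorus.toTorusSite (ofLex o).1 0).val = c₀ ∧
          (FermionTorus.toTorusSite (ofLex o).1 1 = 0 ∨
            FermionTorus.toTorusSite (ofLex o).1 1 = 1)).card ≤ 4 := by
  calc _ ≤ (Finset.range 2 ×ˢ (Finset.univ : Finset (Fin 2))).card := by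
        refine Finset.card_le_card_of_injOn
          (fun o => ((FermionTorus.toTorusSite (ofLex o).1 1).val, (ofLex o).2)) ?_ ?_
        · intro o ho
          simp only [Finset.coe_filter, Finset.mem_univ, true_and, Set.mem_setOf_eq] at ho
          simp only [Finset.coe_product, Finset.coe_range, Finset.coe_univ, Set.mem_prod,
            Set.mem_Iio, Set.mem_univ, and_true]
          rcases ho.2 with h | h <;> rw [h]
          · simp
          · rw [ZMod.val_one_eq_one_mod]; exact lt_of_le_of_lt (Nat.mod_le 1 L) one_lt_two
        · intro o ho o' ho' heq
          simp only [Finset.coe_filter, Finset.mem_univ, true_and, Set.mem_setOf_eq] at ho ho'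
          simp only [Prod.mk.injEq] at heq
          exact orb_fermionTorus_ext (ZMod.val_injective L (ho.1.trans ho'.1.symm))
            (ZMod.val_injective L heq.1) heq.2
    _ = 4 := by simp

/-- A row of the fermionic `2`-torus carries at most `2L` orbitals. [folklore] -/
theorem card_orb_row_le (r₀ : ZMod L) :
    (Finset.univ.filter fun o : Orb (FermionTorus 2 L) =>
        FermionTorus.toTorusSite (ofLex o).1 1 = r₀).card ≤ 2 * L := by
  calc _ ≤ (Finset.range L ×ˢ (Finset.univ : Finset (Fin 2))).card := by
        refine Finset.card_le_card_of_injOn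
          (fun o => ((FermionTorus.toTorusSite (ofLex o).1 0).val, (ofLex o).2)) ?_ ?_
        · intro o _
          simp only [Finset.coe_product, Finset.coe_range, Finset.coe_univ, Set.mem_prod,
            Set.mem_Iio, Set.mem_univ, and_true]
          exact ZMod.val_lt _
        · intro o ho o' ho' heq
          simp only [Finset.coe_filter, Finset.mem_univ, true_and, Set.mem_setOf_eq] at ho ho'
          simp only [Prod.mk.injEq] at heq
          exact orb_fermionTorus_ext (ZMod.val_injective L heq.1) (ho.trans ho'.symm) heq.2
    _ = 2 * L := by simp [mul_comm]

/-- The torus distance of two residues with `a.val < b.val`: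
`min((a−b).val, (b−a).val) = min(a.val + L − b.val, b.val − a.val)`. [folklore] -/
theorem zmod_min_val_sub_eq {a b : ZMod L} (hab : a.val < b.val) :
    min (a - b).val (b - a).val = min (a.val + L - b.val) (b.val - a.val) := by
  have h1 := zmod_val_sub_cases a b
  have h2 := zmod_val_sub_cases b a
  omega

end Torus

end Literature.MathematicalPhysics.QuantumLattice

end
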